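import Literature.NumberTheory.QuadraticFields.ReducedForms
import Literature.NumberTheory.QuadraticFields.SquareRootsModulo
import Mathlib.Tactic.Linarith
import Mathlib.Tactic.Ring
import HarnessLib

/-!
# Lenstra–Pomerance, Lemma 2.10: a reduced form `(a, b, c)` for every small split-smooth `a`

H. W. Lenstra Jr., C. Pomerance, *A rigorous time bound for factoring integers*, J. Amer. Math.
Soc. **5** (1992), §2, Lemma 2.10 (p. 489): *Let `a` be an integer with `1 ≤ a ≤ ½√|Δ|` all of
whose prime factors belong to `𝒫_Δ`. Then there exist `b, c ∈ ℤ` such that `(a, b, c) ∈ C_Δ`* —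
i.e. `(a, b, c)` is a reduced primitive positive definite form of discriminant `Δ`. This is how the
paper injects the `y`-smooth numbers built from split primes (counted by Theorem 6.1,
`Literature.NumberTheory.Sieve.card_factoredUpTo_ge`) into the class group (proof of Theorem 8.1).

`exists_mem_reducedForms_of_split` proves it for odd `a` on the tree's reduced forms
(`Literature.NumberTheory.QuadraticFields.BinaryQuadraticForm.reducedForms`, Cox §2.A): with
`Δ < 0`, `Δ ≡ 0, 1 (mod 4)`, `a` odd, `4a² ≤ −Δ`, and every prime `p ∣ a` satisfying `p ∤ Δ` and
`Δ` a square mod `p` (membership in `𝒫_Δ` for odd `p`), there are `b, c` with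
`(a, b, c) ∈ reducedForms Δ`. The proof is the paper's: `b² ≡ Δ (mod 4a)` is solvable
(`exists_sq_sub_dvd_four_mul`, Hensel + CRT), `b` may be taken in `(−a, a]`, `c = (b² − Δ)/(4a)`
satisfies `4ac = b² + |Δ| ≥ 4a²`, so `a ≤ c` with equality only if `b = 0`, and `gcd(a, b) = 1`
because `gcd(a, b) ∣ Δ` and `gcd(a, Δ) = 1`. (The prime `2 ∈ 𝒫_Δ` iff `Δ ≡ 1 (mod 8)`; even `a`
are not treated here.) Everything is proved.

## References

* H. W. Lenstra Jr., C. Pomerance, J. Amer. Math. Soc. 5 (1992) 483–516, §2, Lemma 2.10, and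
  (2.1)–(2.2) (reduced forms). [LenstraPomerance1992]
* D. A. Cox, *Primes of the form x² + ny²*, 2nd ed., §2.A (2.7). [Cox2013]
-/

namespace Literature.NumberTheory.QuadraticFields.BinaryQuadraticForm

/-- A representative of `b₀` modulo `2a` in the half-open range `(−a, a]` (`a > 0`). [folklore] -/
theorem exists_rep_Ioc {a : ℤ} (ha : 0 < a) (b₀ : ℤ) :
    ∃ b t : ℤ, b = b₀ - 2 * a * t ∧ -a < b ∧ b ≤ a := by
  refine ⟨a - (a - b₀) % (2 * a), -((a - b₀) / (2 * a)), ?_, ?_, ?_⟩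
  · have h := Int.emod_add_mul_ediv (a - b₀) (2 * a)
    linarith
  · have h := Int.emod_lt_of_pos (a - b₀) (show 0 < 2 * a by linarith)
    linarith
  · have h := Int.emod_nonneg (a - b₀) (show 2 * a ≠ 0 by omega)
    linarith

/-- `gcd(a, b) = 1` when every prime factor of `a > 0` fails to divide `b² − 4ac`. [folklore] -/
theorem int_gcd_eq_one_of_primeFactors {a : ℕ} (ha : 0 < a) {b Δ : ℤ} (hbΔ : ∀ g : ℤ, g ∣ a → g ∣ b → g ∣ Δ)
    (hsplit : ∀ p ∈ a.primeFactors, ¬ (p : ℤ) ∣ Δ) : Int.gcd (a : ℤ) b = 1 := by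
  by_contra hg
  set g : ℕ := Int.gcd (a : ℤ) b with hgdef
  have hg0 : g ≠ 0 := by
    intro h0
    rw [hgdef, Int.gcd_eq_zero_iff] at h0
    have : (a : ℤ) = 0 := h0.1
    omega
  set p := g.minFac with hp
  have hpp : p.Prime := Nat.minFac_prime hg
  have hpg : p ∣ g := Nat.minFac_dvd g
  have hga : (g : ℤ) ∣ (a : ℤ) := Int.gcd_dvd_left _ _
  have hgb : (g : ℤ) ∣ b := Int.gcd_dvd_right _ _
  have hpa : (p : ℤ) ∣ (a : ℤ) := (Int.natCast_dvd_natCast.2 hpg).trans hga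
  have hpb : (p : ℤ) ∣ b := (Int.natCast_dvd_natCast.2 hpg).trans hgb
  have hmem : p ∈ a.primeFactors :=
    Nat.mem_primeFactors.2 ⟨hpp, Int.natCast_dvd_natCast.1 hpa, ha.ne'⟩
  exact hsplit p hmem (hbΔ p hpa hpb)

/-- **Lenstra–Pomerance, Lemma 2.10** (odd `a`). Let `Δ < 0`, `Δ ≡ 0` or `1 (mod 4)`, and let
`a` be odd with `4a² ≤ −Δ` such that every prime `p ∣ a` has `p ∤ Δ` and `Δ` a square modulo
`p`. Then there are `b, c ∈ ℤ` for which `(a, b, c)` is a reduced primitive positive definite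
form of discriminant `Δ`, i.e. `(a, b, c) ∈ reducedForms Δ`.
[cite: LenstraPomerance1992, §2 Lemma 2.10] -/
theorem exists_mem_reducedForms_of_split {Δ : ℤ} (hΔ : Δ < 0) (hΔ4 : Δ % 4 = 0 ∨ Δ % 4 = 1)
    {a : ℕ} (hodd : Odd a) (hsize : 4 * (a : ℤ) ^ 2 ≤ -Δ)
    (hsplit : ∀ p ∈ a.primeFactors, ¬ (p : ℤ) ∣ Δ ∧ IsSquare (Δ : ZMod p)) :
    ∃ b c : ℤ, ((a : ℤ), b, c) ∈ reducedForms Δ := by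
  have ha : 0 < a := hodd.pos
  have haZ : (0 : ℤ) < a := by exact_mod_cast ha
  obtain ⟨b₀, hb₀⟩ := exists_sq_sub_dvd_four_mul hΔ4 hodd hsplit
  obtain ⟨b, t, hbt, hb1, hb2⟩ := exists_rep_Ioc haZ b₀
  -- `4a ∣ b² − Δ`
  have hdvd : (4 * a : ℤ) ∣ b ^ 2 - Δ := by
    have e : b ^ 2 - Δ = (b₀ ^ 2 - Δ) + 4 * a * (a * t ^ 2 - b₀ * t) := by rw [hbt]; ring
    rw [e]
    exact dvd_add hb₀ (Dvd.intro _ rfl)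
  obtain ⟨c, hc⟩ := hdvd
  refine ⟨b, c, (mem_reducedForms_iff hΔ).2 ⟨?_, haZ, ?_, ?_⟩⟩
  · -- discriminant
    rw [discr_apply]
    linarith
  · -- primitive: `gcd(a, b) = 1`
    rw [isPrimitive_iff]
    have h1 : Int.gcd (a : ℤ) b = 1 := by
      refine int_gcd_eq_one_of_primeFactors ha (fun g hga hgb => ?_) fun p hp => (hsplit p hp).1
      have e : Δ = b ^ 2 - 4 * a * c := by linarith
      rw [e]
      exact dvd_sub (dvd_pow hgb two_ne_zero) ((hga.mul_left 4).mul_right c)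
    rw [h1]
    exact Int.gcd_one_left c
  · -- reduced: `-a < b ≤ a ≤ c`, and `b ≥ 0` in the boundary cases
    have hac : (a : ℤ) ≤ c := by
      -- `4ac = b² − Δ ≥ −Δ ≥ 4a²`
      have h1 : 4 * (a : ℤ) * c ≥ 4 * (a : ℤ) * a := by nlinarith
      nlinarith
    refine ⟨by simp only; linarith, by simp only; exact hb2, by simp only; exact hac, ?_⟩
    simp only
    rintro (h | h | h)
    · linarith
    · linarith
    · -- `a = c` forces `b = 0`
      have : b ^ 2 ≤ 0 := by nlinarith
      nlinarith

end Literature.NumberTheory.QuadraticFields.BinaryQuadraticForm
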